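import Summits.NavierStokesRegularity.FunctionalMining.TopEigHeatDanskin
import HarnessLib

/-!
# NO-GO K51 — INTEGER exactness is universal exactness is LEVEL-WISE BALANCE (gen 50, touch 10)

Search for candidate a priori estimates; no regularity claim.

Door (b) = (F2) of `NOGO.md` wants a kernel `¬ TopEigHeatCoercivePos q` for a real `q > 1`, i.e. a
smooth divergence-free zero-mean design `v` on `T³` with `Φ_q(v) = ∫ (λ₁⁺)^q > 0` and
`heatDissipation Φ_q v = 0` ("exact at `q`"). K50 (`TopEigHeatExactExponents`, staged) proved the
dichotomy: the exact exponents of ONE field are isolated in `(1, ∞)`, or `v` is exact at EVERY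
`q > 1` ("universal"; forced by exactness on any set of exponents accumulating INSIDE `(1, ∞)`).
This file characterises the universal branch ELEMENTARILY, and sharpens it: exactness at the
INTEGER exponents `q = 2, 3, 4, …` — which accumulate only at `∞`, outside K50's reach — already
forces universality.

With `λ₁ = torusStrainTopEig v ≥ 0` (top eigenvalue of the strain, any dimension `d`) and the
Danskin mass `μ(x) = dirTopEig (S v x) (S Δv x)`, Danskin's formula (tree, `TopEigHeatDanskin`)
reads `heatDissipation Φ_q v = −∫ q λ₁^{q−1} μ` for `q ≥ 1`. Hence

* § 2: exact at `q` ⇔ the tilted moment `∫ λ₁^{q−1} μ` vanishes; exact at the integers `q ≥ 2` ⇒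
  the integer moments `∫ λ₁^n μ = 0`, `n ≥ 1`, vanish.
* § 3: then `∫ p(λ₁) μ = 0` for every real polynomial with `p(0) = 0`, and — Weierstrass
  approximation on `[0, max λ₁]` (`exists_polynomial_near_of_continuousOn`), the Danskin mass being
  integrable — `∫ φ(λ₁) μ = 0` for every CONTINUOUS `φ : ℝ → ℝ` with `φ(0) = 0`
  (`integral_comp_mul_dirTopEig_eq_zero`, stated for a general direction `w`): the Danskin mass is
  BALANCED ON EVERY LEVEL of `λ₁` (the signed measure `(λ₁)_* (μ dx)` vanishes on `(0, ∞)`;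
  Hausdorff-moment rigidity). The level `λ₁ = 0` (= the zero set of the trace-free `S`) is
  invisible to every moment, whence `φ(0) = 0`.
* § 4 (headlines, any `d`): **`exact_all_of_exact_nat`** — exact at every integer `q ≥ 2` ⇒ exact
  at every real `q > 1`; **`exact_all_iff_levelBalanced`** — universal IFF `∫ φ(λ₁) μ = 0` for all
  continuous `φ` with `φ(0) = 0` (converse: Danskin's formula with `φ(l) = l^{q−1}`);
  `exact_all_iff_exact_nat`.
* § 5 (design rule): if the Danskin mass keeps a STRICT SIGN on a spectral window
  `{x : c < λ₁(x) < c'}` with `c ≥ 0` that the design actually visits, then some INTEGER exponent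
  `n ≥ 2` is non-exact (`exists_nonexact_of_dirTopEig_pos_on_window`, `…_neg_on_window`; test
  function the tent `φ(l) = max (min (l − c) (c' − l)) 0`, Haar measure charges open sets).

MEANING FOR (F2) (design rule (R9), on top of K42–K50). K47 (R1) asked for ONE balanced tilted
average `∫ λ₁^{q−1} μ = 0` at the target exponent. A design exact on a band of exponents (K50
(R8)), or merely at every integer exponent, is universal and must balance its Danskin mass on
EVERY spectral window of `λ₁` above level `0`: wherever the design's top eigenvalue takes values
in `(c, c')`, the heat variation `μ = d/dt λ₁(S(v + tΔv))` at `t = 0⁺` must change sign (or vanish)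
there. Single-exponent exactness is one linear condition on the level law of `λ₁` weighted by
`μ`; integer / band exactness is all of them. A search sweeping the integer exponents `q = 2, 3, …`
with ONE design either finds a non-exact integer or has found a universal witness.

HONEST CAVEAT. Structure only: no design is constructed and neither branch of K50's dichotomy is
excluded; the statements hold in every dimension and say nothing about `T³`-coercivity constants;
nothing at `q = 1`; no node of `NOGO.md` is decided; L-λ(q) stays OPEN for every real `q > 1`.
NOT CLAIMED: any value of `C_λ(q)`, any regularity statement for Navier–Stokes.

Tree facts used: `heatDissipation_topEigMoment_eq_integral`,
`aestronglyMeasurable_danskinDensity`, `integrable_danskinDensity`, `continuous_torusStrainTopEig`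
(TopEigHeatDanskin), `lam_strainFlat`, `lam_strainFlat_nonneg` (TopEigRayleighSpectral); Mathlib's
`exists_polynomial_near_of_continuousOn`, `Polynomial.eval_eq_sum_range`,
`integral_pos_iff_support_of_nonneg_ae`, `IsOpen.measure_pos` (Haar measure charges open sets).

search for candidate a priori estimates; no regularity claim.
FILING (prove seat g29, REQUEST #77): declarations byte-identical to the no-go seat's staged `TopEigHeatLevelBalance.STAGING.lean` b37c48e010a2e978; this line is the only addition.
-/

noncomputable section

open MeasureTheory Set Filter Topology Polynomial

namespace Summit.NavierStokesRegularity.FunctionalMining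

open Literature.Analysis.FunctionSpaces

namespace TopEig

variable {d : Type*} [Fintype d] [DecidableEq d] [Nonempty d]
variable {v w : UnitAddTorus d → EuclideanSpace ℝ d}

/-! ## 1. Integrability of `φ(λ₁) · μ` -/

omit [DecidableEq d] [Nonempty d] in
/-- A continuous function of a continuous scalar field times an integrable function is integrable
on the (compact) torus. [folklore] -/
theorem integrable_comp_mul_of_continuous {lam g : UnitAddTorus d → ℝ} (hlam : Continuous lam)
    (hg : Integrable g volume) {φ : ℝ → ℝ} (hφ : Continuous φ) :
    Integrable (fun x => φ (lam x) * g x) volume := by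
  have hc : Continuous fun x => φ (lam x) := hφ.comp hlam
  obtain ⟨x₀, -, hx₀⟩ :=
    isCompact_univ.exists_isMaxOn univ_nonempty (continuous_norm.comp hc).continuousOn
  exact hg.bdd_mul hc.aestronglyMeasurable (c := ‖φ (lam x₀)‖)
    (ae_of_all _ fun x => hx₀ (mem_univ x))

/-- The Danskin mass `x ↦ μ(S v x; S w x)` is a.e. strongly measurable (`q = 1` in the tree's
`aestronglyMeasurable_danskinDensity`). [ours] -/
theorem aestronglyMeasurable_dirTopEig_strainFlat (hv : Torus.IsSmooth v)
    (hw : Torus.IsSmooth w) :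
    AEStronglyMeasurable
      (fun x => dirTopEig (StrainL4.strainFlat v x) (StrainL4.strainFlat w x)) volume := by
  simpa using aestronglyMeasurable_danskinDensity (q := 1) le_rfl hv hw

/-- The Danskin mass is integrable (`|μ| ≤ ‖S w‖`; `q = 1` in `integrable_danskinDensity`).
[ours] -/
theorem integrable_dirTopEig_strainFlat (hv : Torus.IsSmooth v) (hw : Torus.IsSmooth w)
    (hdv : Torus.IsDivFree v) :
    Integrable (fun x => dirTopEig (StrainL4.strainFlat v x) (StrainL4.strainFlat w x)) volume := by
  simpa using integrable_danskinDensity (q := 1) le_rfl hv hw hdv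

/-! ## 2. Exactness and tilted moments -/

/-- Exactness at one exponent `q > 1` is the vanishing of the tilted moment
`∫ λ₁^{q−1} μ(S v; S Δv) = 0` (Danskin's formula, `q ≠ 0`). [ours] -/
theorem integral_rpow_mul_dirTopEig_eq_zero_iff_exact {q : ℝ} (hq : 1 < q)
    (hv : Torus.IsSmooth v) (hdiv : Torus.IsDivFree v) :
    (∫ x, torusStrainTopEig v x ^ (q - 1) *
        dirTopEig (StrainL4.strainFlat v x) (StrainL4.strainFlat (Torus.laplacian v) x)) = 0 ↔
      heatDissipation (torusTopEigMoment q) v = 0 := by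
  have hq0 : q ≠ 0 := by positivity
  have hform : heatDissipation (torusTopEigMoment q) v =
      -(q * ∫ x, torusStrainTopEig v x ^ (q - 1) *
        dirTopEig (StrainL4.strainFlat v x) (StrainL4.strainFlat (Torus.laplacian v) x)) := by
    rw [heatDissipation_topEigMoment_eq_integral hq.le hv hdiv, ← integral_const_mul]
    congr 1
    exact integral_congr_ae (ae_of_all _ fun x => by ring)
  rw [hform, neg_eq_zero, mul_eq_zero, or_iff_right hq0]

/-- Exactness at the INTEGER exponents `q = 2, 3, …` gives vanishing integer moments
`∫ λ₁^n μ(S v; S Δv) = 0`, `n ≥ 1` (`q = n + 1` in the previous lemma). [ours] -/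
theorem integral_pow_mul_dirTopEig_eq_zero_of_exact_nat (hv : Torus.IsSmooth v)
    (hdiv : Torus.IsDivFree v)
    (hN : ∀ n : ℕ, 2 ≤ n → heatDissipation (torusTopEigMoment n) v = 0) {n : ℕ} (hn : 1 ≤ n) :
    (∫ x, torusStrainTopEig v x ^ n *
      dirTopEig (StrainL4.strainFlat v x) (StrainL4.strainFlat (Torus.laplacian v) x)) = 0 := by
  have hn1 : (1 : ℝ) < (n : ℝ) + 1 := by
    have : (1 : ℝ) ≤ n := by exact_mod_cast hn
    linarith
  have h := hN (n + 1) (by omega)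
  push_cast at h
  have h' := (integral_rpow_mul_dirTopEig_eq_zero_iff_exact hn1 hv hdiv).mpr h
  simpa [add_sub_cancel_right, Real.rpow_natCast] using h'

/-! ## 3. From moments to every continuous function of the level: Weierstrass -/

/-- Vanishing integer moments `∫ λ₁^n μ(S v; S w) = 0`, `n ≥ 1` ⇒ `∫ p(λ₁) μ = 0` for every real
polynomial `p` with `p(0) = 0` (expand in monomials; the constant term is `p(0) = 0`). Stated for a
general smooth direction `w`. [ours] -/
theorem integral_polynomial_comp_mul_dirTopEig_eq_zero (hv : Torus.IsSmooth v)
    (hw : Torus.IsSmooth w) (hdv : Torus.IsDivFree v)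
    (hM : ∀ n : ℕ, 1 ≤ n → (∫ x, torusStrainTopEig v x ^ n *
      dirTopEig (StrainL4.strainFlat v x) (StrainL4.strainFlat w x)) = 0)
    (p : ℝ[X]) (hp : p.eval 0 = 0) :
    (∫ x, p.eval (torusStrainTopEig v x) *
      dirTopEig (StrainL4.strainFlat v x) (StrainL4.strainFlat w x)) = 0 := by
  have hμ := integrable_dirTopEig_strainFlat hv hw hdv
  have hlam := continuous_torusStrainTopEig hv
  have hterm : ∀ i ∈ Finset.range (p.natDegree + 1), Integrable (fun x => p.coeff i *
      (torusStrainTopEig v x ^ i *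
        dirTopEig (StrainL4.strainFlat v x) (StrainL4.strainFlat w x))) volume :=
    fun i _ => (integrable_comp_mul_of_continuous hlam hμ (continuous_pow i)).const_mul _
  calc (∫ x, p.eval (torusStrainTopEig v x) *
        dirTopEig (StrainL4.strainFlat v x) (StrainL4.strainFlat w x))
      = ∫ x, ∑ i ∈ Finset.range (p.natDegree + 1), p.coeff i * (torusStrainTopEig v x ^ i *
          dirTopEig (StrainL4.strainFlat v x) (StrainL4.strainFlat w x)) := by
        refine integral_congr_ae (ae_of_all _ fun x => ?_)
        simp only [Polynomial.eval_eq_sum_range, Finset.sum_mul, mul_assoc]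
    _ = ∑ i ∈ Finset.range (p.natDegree + 1), ∫ x, p.coeff i * (torusStrainTopEig v x ^ i *
          dirTopEig (StrainL4.strainFlat v x) (StrainL4.strainFlat w x)) :=
        integral_finsetSum _ hterm
    _ = 0 := Finset.sum_eq_zero fun i _ => by
        rw [integral_const_mul]
        rcases Nat.eq_zero_or_pos i with rfl | hi
        · simp [Polynomial.coeff_zero_eq_eval_zero, hp]
        · rw [hM i hi, mul_zero]

/-- **Level-wise balance from vanishing integer moments (Hausdorff–Weierstrass rigidity).** If
`∫ λ₁^n μ(S v; S w) = 0` for every integer `n ≥ 1`, then `∫ φ(λ₁) μ(S v; S w) = 0` for every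
continuous `φ : ℝ → ℝ` with `φ(0) = 0` (Weierstrass approximation on `[0, max λ₁]`, integrable
Danskin mass): the moments `n ≥ 1` determine the level law of `λ₁` weighted by `μ` off level `0`.
[ours] -/
theorem integral_comp_mul_dirTopEig_eq_zero (hv : Torus.IsSmooth v) (hw : Torus.IsSmooth w)
    (hdv : Torus.IsDivFree v)
    (hM : ∀ n : ℕ, 1 ≤ n → (∫ x, torusStrainTopEig v x ^ n *
      dirTopEig (StrainL4.strainFlat v x) (StrainL4.strainFlat w x)) = 0)
    {φ : ℝ → ℝ} (hφ : Continuous φ) (hφ0 : φ 0 = 0) :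
    (∫ x, φ (torusStrainTopEig v x) *
      dirTopEig (StrainL4.strainFlat v x) (StrainL4.strainFlat w x)) = 0 := by
  set lam := torusStrainTopEig v with hlam_def
  set g := fun x => dirTopEig (StrainL4.strainFlat v x) (StrainL4.strainFlat w x) with hg_def
  have hlc : Continuous lam := continuous_torusStrainTopEig hv
  have hμ : Integrable g volume := integrable_dirTopEig_strainFlat hv hw hdv
  obtain ⟨x₀, -, hx₀⟩ := isCompact_univ.exists_isMaxOn univ_nonempty hlc.continuousOn
  have hlB : ∀ x, lam x ∈ Icc 0 (lam x₀) := fun x =>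
    ⟨by rw [hlam_def, ← lam_strainFlat]; exact lam_strainFlat_nonneg hv hdv x, hx₀ (mem_univ x)⟩
  have hB0 : (0 : ℝ) ∈ Icc 0 (lam x₀) := ⟨le_rfl, (hlB x₀).1⟩
  set K := ∫ x, |g x| with hK_def
  have hK : 0 ≤ K := integral_nonneg fun _ => abs_nonneg _
  have key : ∀ ε : ℝ, 0 < ε → |∫ x, φ (lam x) * g x| ≤ 2 * ε * K := by
    intro ε hε
    obtain ⟨p, hp⟩ := exists_polynomial_near_of_continuousOn 0 (lam x₀) φ hφ.continuousOn ε hε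
    set p0 : ℝ[X] := p - C (p.eval 0) with hp0_def
    have hp00 : p0.eval 0 = 0 := by simp [hp0_def]
    have hnear : ∀ l ∈ Icc (0 : ℝ) (lam x₀), |φ l - p0.eval l| ≤ 2 * ε := by
      intro l hl
      have h1 := hp l hl
      have h2 := hp 0 hB0
      rw [hφ0, sub_zero] at h2
      have : φ l - p0.eval l = p.eval 0 - (p.eval l - φ l) := by
        simp only [hp0_def, eval_sub, eval_C]; ring
      rw [this]
      exact (abs_sub _ _).trans (by linarith [h1.le, h2.le])
    have hIp0 : (∫ x, p0.eval (lam x) * g x) = 0 :=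
      integral_polynomial_comp_mul_dirTopEig_eq_zero hv hw hdv hM p0 hp00
    have hi1 : Integrable (fun x => φ (lam x) * g x) volume :=
      integrable_comp_mul_of_continuous hlc hμ hφ
    have hi2 : Integrable (fun x => p0.eval (lam x) * g x) volume :=
      integrable_comp_mul_of_continuous hlc hμ p0.continuous
    have hsub : (∫ x, φ (lam x) * g x) = ∫ x, (φ (lam x) - p0.eval (lam x)) * g x := by
      rw [← sub_zero (∫ x, φ (lam x) * g x), ← hIp0, ← integral_sub hi1 hi2]
      exact integral_congr_ae (ae_of_all _ fun x => by ring)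
    rw [hsub]
    have hbound := norm_integral_le_of_norm_le (f := fun x => (φ (lam x) - p0.eval (lam x)) * g x)
      (g := fun x => 2 * ε * |g x|) (hμ.abs.const_mul _) (ae_of_all _ fun x => by
        rw [Real.norm_eq_abs, abs_mul]
        exact mul_le_mul_of_nonneg_right (hnear _ (hlB x)) (abs_nonneg _))
    rw [integral_const_mul] at hbound
    simpa [Real.norm_eq_abs] using hbound
  have h0 : |∫ x, φ (lam x) * g x| ≤ 0 := by
    refine le_of_forall_pos_le_add fun ε hε => ?_
    have h := key (ε / (2 * (K + 1))) (by positivity)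
    have hKK : K / (K + 1) ≤ 1 := (div_le_one (by linarith)).mpr (by linarith)
    calc |∫ x, φ (lam x) * g x| ≤ 2 * (ε / (2 * (K + 1))) * K := h
      _ = ε * (K / (K + 1)) := by field_simp
      _ ≤ 0 + ε := by rw [zero_add]; exact mul_le_of_le_one_right hε.le hKK
  exact abs_nonpos_iff.mp h0

/-! ## 4. Headline: integer exactness = universal exactness = level-wise balance -/

/-- **Integer-exact ⇒ level-balanced.** A smooth divergence-free `v` (any `d`) that is exact at
every INTEGER exponent `q = 2, 3, …` has `∫ φ(λ₁) μ(S v; S Δv) = 0` for every continuous `φ` with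
`φ(0) = 0`. [ours] -/
theorem levelBalanced_of_exact_nat (hv : Torus.IsSmooth v) (hdiv : Torus.IsDivFree v)
    (hN : ∀ n : ℕ, 2 ≤ n → heatDissipation (torusTopEigMoment n) v = 0)
    {φ : ℝ → ℝ} (hφ : Continuous φ) (hφ0 : φ 0 = 0) :
    (∫ x, φ (torusStrainTopEig v x) *
      dirTopEig (StrainL4.strainFlat v x) (StrainL4.strainFlat (Torus.laplacian v) x)) = 0 :=
  integral_comp_mul_dirTopEig_eq_zero hv hv.laplacian hdiv
    (fun _ hn => integral_pow_mul_dirTopEig_eq_zero_of_exact_nat hv hdiv hN hn) hφ hφ0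

/-- **Level-balanced ⇒ universal** (Danskin's formula with `φ(l) = l^{q−1}`, continuous and
vanishing at `0` for `q > 1`). [ours] -/
theorem exact_all_of_levelBalanced (hv : Torus.IsSmooth v) (hdiv : Torus.IsDivFree v)
    (hB : ∀ φ : ℝ → ℝ, Continuous φ → φ 0 = 0 → (∫ x, φ (torusStrainTopEig v x) *
      dirTopEig (StrainL4.strainFlat v x) (StrainL4.strainFlat (Torus.laplacian v) x)) = 0)
    {q : ℝ} (hq : 1 < q) : heatDissipation (torusTopEigMoment q) v = 0 := by
  have hq1 : q - 1 ≠ 0 := by linarith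
  have hφ : Continuous fun l : ℝ => l ^ (q - 1) := Real.continuous_rpow_const (by linarith)
  exact (integral_rpow_mul_dirTopEig_eq_zero_iff_exact hq hv hdiv).mp
    (hB _ hφ (Real.zero_rpow hq1))

/-- **INTEGER EXACTNESS IS UNIVERSAL EXACTNESS (any `d`).** A smooth divergence-free `v` exact at
every integer exponent `q = 2, 3, 4, …` is exact at EVERY real `q > 1`. The integers accumulate
only at `∞`, so this is not K50's identity theorem: it is the moment rigidity of the level law of
`λ₁` (Weierstrass). [ours] -/
theorem exact_all_of_exact_nat (hv : Torus.IsSmooth v) (hdiv : Torus.IsDivFree v)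
    (hN : ∀ n : ℕ, 2 ≤ n → heatDissipation (torusTopEigMoment n) v = 0) {q : ℝ} (hq : 1 < q) :
    heatDissipation (torusTopEigMoment q) v = 0 :=
  exact_all_of_levelBalanced hv hdiv (fun _ hφ hφ0 => levelBalanced_of_exact_nat hv hdiv hN hφ hφ0)
    hq

/-- **Headline (any `d`).** For smooth divergence-free `v`: exact at every real `q > 1` IFF the
Danskin mass `μ(S v; S Δv)` is balanced on every level of `λ₁`: `∫ φ(λ₁) μ = 0` for all
continuous `φ` with `φ(0) = 0`. [ours] -/
theorem exact_all_iff_levelBalanced (hv : Torus.IsSmooth v) (hdiv : Torus.IsDivFree v) :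
    (∀ q : ℝ, 1 < q → heatDissipation (torusTopEigMoment q) v = 0) ↔
      ∀ φ : ℝ → ℝ, Continuous φ → φ 0 = 0 → (∫ x, φ (torusStrainTopEig v x) *
        dirTopEig (StrainL4.strainFlat v x) (StrainL4.strainFlat (Torus.laplacian v) x)) = 0 :=
  ⟨fun hU _ hφ hφ0 => levelBalanced_of_exact_nat hv hdiv
      (fun n hn => hU n (by exact_mod_cast (by omega : 1 < n))) hφ hφ0,
    fun hB _ hq => exact_all_of_levelBalanced hv hdiv hB hq⟩

/-- **Headline, integer form.** Exact at every real `q > 1` IFF exact at every integer `q ≥ 2`.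
[ours] -/
theorem exact_all_iff_exact_nat (hv : Torus.IsSmooth v) (hdiv : Torus.IsDivFree v) :
    (∀ q : ℝ, 1 < q → heatDissipation (torusTopEigMoment q) v = 0) ↔
      ∀ n : ℕ, 2 ≤ n → heatDissipation (torusTopEigMoment n) v = 0 :=
  ⟨fun hU n hn => hU n (by exact_mod_cast (by omega : 1 < n)),
    fun hN _ hq => exact_all_of_exact_nat hv hdiv hN hq⟩

/-! ## 5. Design rule: a strict sign of `μ` on a visited spectral window forbids universality -/

omit [DecidableEq d] [Nonempty d] in
/-- Tent-test positivity: if an integrable `g` is strictly positive on the (visited) window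
`{c < lam < c'}` of a continuous `lam`, then `∫ tent(lam) · g > 0` for the tent
`tent(l) = max (min (l − c) (c' − l)) 0` supported in the window. [folklore] -/
theorem integral_tent_comp_mul_pos {lam g : UnitAddTorus d → ℝ} (hlam : Continuous lam)
    (hg : Integrable g volume) {c c' : ℝ} (hne : ∃ x, c < lam x ∧ lam x < c')
    (hpos : ∀ x, c < lam x → lam x < c' → 0 < g x) :
    0 < ∫ x, max (min (lam x - c) (c' - lam x)) 0 * g x := by
  have htent : Continuous fun l : ℝ => max (min (l - c) (c' - l)) 0 := by fun_prop
  have hint : Integrable (fun x => max (min (lam x - c) (c' - lam x)) 0 * g x) volume :=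
    integrable_comp_mul_of_continuous hlam hg htent
  have hzero : ∀ x, ¬ (c < lam x ∧ lam x < c') → max (min (lam x - c) (c' - lam x)) 0 = 0 := by
    intro x hx
    refine max_eq_right ?_
    by_cases h1 : c < lam x
    · exact min_le_of_right_le (by linarith [not_and.mp hx h1 |> not_lt.mp])
    · exact min_le_of_left_le (by linarith [not_lt.mp h1])
  have hnn : 0 ≤ᵐ[volume] fun x => max (min (lam x - c) (c' - lam x)) 0 * g x := by
    refine ae_of_all _ fun x => ?_
    by_cases hx : c < lam x ∧ lam x < c'
    · exact mul_nonneg (le_max_right _ _) (hpos x hx.1 hx.2).le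
    · simp only [Pi.zero_apply, hzero x hx, zero_mul, le_refl]
  have hsupp : lam ⁻¹' Ioo c c' ⊆
      Function.support fun x => max (min (lam x - c) (c' - lam x)) 0 * g x := by
    intro x hx
    have hx' : c < lam x ∧ lam x < c' := hx
    have htpos : 0 < max (min (lam x - c) (c' - lam x)) 0 :=
      lt_max_of_lt_left (lt_min (by linarith [hx'.1]) (by linarith [hx'.2]))
    exact (mul_pos htpos (hpos x hx'.1 hx'.2)).ne'
  have hopen : IsOpen (lam ⁻¹' Ioo c c') := isOpen_Ioo.preimage hlam
  obtain ⟨x, hx⟩ := hne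
  have hmeas : 0 < volume (lam ⁻¹' Ioo c c') := hopen.measure_pos volume ⟨x, hx⟩
  exact (integral_pos_iff_support_of_nonneg_ae hnn hint).mpr (hmeas.trans_le (measure_mono hsupp))

/-- **Design rule (R9), positive sign.** If the Danskin mass `μ(S v; S Δv)` is strictly POSITIVE on
a visited spectral window `{c < λ₁ < c'}` with `c ≥ 0`, then `v` is not universal: some INTEGER
exponent `n ≥ 2` is non-exact (tent test function, `tent(0) = 0` because `c ≥ 0`). [ours] -/
theorem exists_nonexact_of_dirTopEig_pos_on_window (hv : Torus.IsSmooth v)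
    (hdiv : Torus.IsDivFree v) {c c' : ℝ} (hc : 0 ≤ c)
    (hne : ∃ x, c < torusStrainTopEig v x ∧ torusStrainTopEig v x < c')
    (hpos : ∀ x, c < torusStrainTopEig v x → torusStrainTopEig v x < c' →
      0 < dirTopEig (StrainL4.strainFlat v x) (StrainL4.strainFlat (Torus.laplacian v) x)) :
    ∃ n : ℕ, 2 ≤ n ∧ heatDissipation (torusTopEigMoment n) v ≠ 0 := by
  by_contra hcon
  have hN : ∀ n : ℕ, 2 ≤ n → heatDissipation (torusTopEigMoment n) v = 0 :=
    fun n hn => by by_contra h; exact hcon ⟨n, hn, h⟩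
  have htent : Continuous fun l : ℝ => max (min (l - c) (c' - l)) 0 := by fun_prop
  have h0 := levelBalanced_of_exact_nat hv hdiv hN htent
    (max_eq_right (min_le_of_left_le (by linarith)))
  have hlt := integral_tent_comp_mul_pos (continuous_torusStrainTopEig hv)
    (integrable_dirTopEig_strainFlat hv hv.laplacian hdiv) hne hpos
  exact hlt.ne' h0

/-- **Design rule (R9), negative sign.** The same with `μ < 0` on the window (tent test applied
to `−μ`). [ours] -/
theorem exists_nonexact_of_dirTopEig_neg_on_window (hv : Torus.IsSmooth v)
    (hdiv : Torus.IsDivFree v) {c c' : ℝ} (hc : 0 ≤ c)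
    (hne : ∃ x, c < torusStrainTopEig v x ∧ torusStrainTopEig v x < c')
    (hneg : ∀ x, c < torusStrainTopEig v x → torusStrainTopEig v x < c' →
      dirTopEig (StrainL4.strainFlat v x) (StrainL4.strainFlat (Torus.laplacian v) x) < 0) :
    ∃ n : ℕ, 2 ≤ n ∧ heatDissipation (torusTopEigMoment n) v ≠ 0 := by
  by_contra hcon
  have hN : ∀ n : ℕ, 2 ≤ n → heatDissipation (torusTopEigMoment n) v = 0 :=
    fun n hn => by by_contra h; exact hcon ⟨n, hn, h⟩
  have htent : Continuous fun l : ℝ => max (min (l - c) (c' - l)) 0 := by fun_prop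
  have h0 := levelBalanced_of_exact_nat hv hdiv hN htent
    (max_eq_right (min_le_of_left_le (by linarith)))
  have hlt := integral_tent_comp_mul_pos
    (g := fun x =>
      -dirTopEig (StrainL4.strainFlat v x) (StrainL4.strainFlat (Torus.laplacian v) x))
    (continuous_torusStrainTopEig hv) (integrable_dirTopEig_strainFlat hv hv.laplacian hdiv).neg
    hne (fun x h1 h2 => neg_pos.mpr (hneg x h1 h2))
  have hrw : (∫ x, max (min (torusStrainTopEig v x - c) (c' - torusStrainTopEig v x)) 0 *
      -dirTopEig (StrainL4.strainFlat v x) (StrainL4.strainFlat (Torus.laplacian v) x)) =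
      -∫ x, max (min (torusStrainTopEig v x - c) (c' - torusStrainTopEig v x)) 0 *
        dirTopEig (StrainL4.strainFlat v x) (StrainL4.strainFlat (Torus.laplacian v) x) := by
    rw [← integral_neg]
    exact integral_congr_ae (ae_of_all _ fun x => by ring)
  rw [hrw, h0, neg_zero] at hlt
  exact lt_irrefl _ hlt

/-- **Single exponent vs. all levels.** Exactness at ONE `q > 1` is one balanced tilted average;
universality is balance on every level: if `v` is exact at `q` but its Danskin mass is strictly
positive on some visited window `{c < λ₁ < c'}`, `c ≥ 0`, then some integer exponent `n ≠ q` is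
non-exact — `q`'s exactness is not shared by all exponents (by K50, staged, `q` is then an
isolated exact exponent). [ours] -/
theorem exact_not_universal_of_pos_window (hv : Torus.IsSmooth v) (hdiv : Torus.IsDivFree v)
    {q : ℝ} (hD : heatDissipation (torusTopEigMoment q) v = 0) {c c' : ℝ} (hc : 0 ≤ c)
    (hne : ∃ x, c < torusStrainTopEig v x ∧ torusStrainTopEig v x < c')
    (hpos : ∀ x, c < torusStrainTopEig v x → torusStrainTopEig v x < c' →
      0 < dirTopEig (StrainL4.strainFlat v x) (StrainL4.strainFlat (Torus.laplacian v) x)) :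
    ∃ n : ℕ, 2 ≤ n ∧ (n : ℝ) ≠ q ∧ heatDissipation (torusTopEigMoment n) v ≠ 0 := by
  obtain ⟨n, hn, hne'⟩ := exists_nonexact_of_dirTopEig_pos_on_window hv hdiv hc hne hpos
  refine ⟨n, hn, ?_, hne'⟩
  rintro rfl
  exact hne' hD

end TopEig

end Summit.NavierStokesRegularity.FunctionalMining

end

-- search for candidate a priori estimates; no regularity claim
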